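import Summits.Ventures.CertifiedManyBodySolver.Downfold.BoxesHg1201ULadderSlab3Doors
import Summits.Ventures.CertifiedManyBodySolver.Downfold.BoxesHg1201ELadderLeafDoors
import HarnessLib

/-!
# The U-direction ladder of Hg-1201, part 11: THE REGISTERED K1 `U`-SEGMENTS `[7/2, 5]` ∪ `[5, 44/5]`, READ ON THE LADDER — what ONE segment's
# strip certificate certifies, rung by rung, before the other segment lands (@0, both columns)

Venture CertifiedManyBodySolver, cell `pub/hubbard-downfold` (MO-S1 → S2 seam; D-0154 (1)(C) COVERAGE (ii) HgBa₂CuO₄₊δ «Hg-1201»), seat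
`hubbard-cov-hg1201-unc-1` (lane U MEMBERS + QUOTIENT; rulings R-ma / R-mb (b) / R-mc (a)(b) / R-me (a)); namespace
`Summit.Ventures.CertifiedManyBodySolver.Downfold`. Parts 1–10 of this lane: `BoxesHg1201ULadder` (p607319) … `BoxesHg1201ELadderLeafDoors` (part 10, p623001).
Numbers: `router/BOXES/HgBa2CuO4.md` §OF-RECORD v1.14 (sha16 `e6e92f5cad3bfba1`, unchanged).

THE OBJECT. Route `CovHg1201M19b` (route-Ventures-CovHg1201M19b, OPEN · READY) owes its corner-patch certificate as K1 «PatchLeftEdge» (stmt-Ventures-26186)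
∧ K2 «PatchBottom» (-26187); K1's registered BC3 stubs SPLIT THE LEFT EDGE AT `U′ = 5`: `stub_leftEdge_lowU` (`U′ ∈ [7/2, 5]`, pinned pair «PIN-HG-U», hub
A7o2 j300184) and `stub_leftEdge_highU` (`U′ ∈ [5, 44/5]`, «PIN-HG-U′», hub A5 j300186) — two solves hours apart (captain HG1201-COVERAGE-PLAN v0.3 Δ2/Δ4). The
split value `5` is ALSO unc-2's slab cut of record (`boxHg1201E_M19b_slabLo = M19b ∩ {U/t ∈ [7/2, 5]}`, `…_slabHi = M19b ∩ {U/t ∈ [5, 44/5]}`,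
`BoxesHg1201ETnLadder` §3–§4, with cell-leaf doors and `Hg1201M19b_StiffnessBoxCeiling_of_slabWords`) and part 5's banking threshold `U† = 5` (census
`hg1201U_bank5_full` 12 / `_straddle` 3 / Jang 1). This file types, for the INTERIM STATE in which ONE segment's strip certificate is in hand and the
other is not, exactly which admitted determinations already carry a certified `c ≤ bar` — and on which `t_eff` range — by composing box-2's
`U`-parametric strip cover (`hg1201M19b_cell_of_cornerStrip`, n-cut `179/200`; `hg1201M19_cell_of_cornerPatch`, patch `n ∈ [67/80, 22/25]`) with unc-2's
slab doors and part 7's `oneBandPointE_mem_M19b_sliceU` / `…M19_sliceU`. How a strip CELL statement arises from the registered stub + K2 (left-edge and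
bottom box rows transported by the target-slot theorem) is box-1's adapter lane (`Theorems/CovHg1201M19bStubAdapters`, `…StripClosers`:
`covHg1201M19b_leftEdgeSegment_of_boxRow`, `covHg1201M19b_leaf_of_threeStripCellsW`) and is NOT restated here.

* §S1 THE SEGMENTS' EXACT `U`-REACH ON THE eV AXIS (iff, `t_eff ∈ [1/2, 3/5]`): lower segment `U/t ∈ [7/2, 5]` at every `t_eff` ⇔ `U ∈ [21/10, 5/2]` eV;
  upper segment `U/t ∈ [5, 44/5]` ⇔ `U ∈ [3, 22/5]` eV; the gap `(5/2, 3)` holds exactly part 5's three STRADDLE members (in-house (W) `2.865`, Teranishi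
  `2.9462`, Vučičević `2.98`), the lower reach exactly the Jang band `2.15 ± 0.05`, the upper reach the 11 members `3.335 … 4.37` (`hg1201U_bank5_full` less
  mRPA@QSGW `5.2`, which needs the third slab, part 9): 1 + 3 + 11 + 1 = 16 (`hg1201E_K1split_ladder_census`).
* §S2 p = ⅛ COLUMN (bar `0.5166800`): strip certificate on `[−27/50, −13/25] × [7/2, 5] × [179/200, 183/200]` ⇒ `StiffnessBoxCeilingBelow boxHg1201E_M19b_slabLo`;
  the same on `[5, 44/5]` ⇒ `…_slabHi`; both ⇒ the leaf (`Hg1201M19b_StiffnessBoxCeiling_of_twoSegmentStrips`, two constants); RUNG READINGS: a slabLo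
  ceiling certifies every `U ∈ [21/10, 5/2]` at every `t_eff` AND each straddle member `m` on `t_eff ∈ [m/5, 3/5]`; a slabHi ceiling certifies every
  `U ∈ [3, 22/5]` at every `t_eff` AND each straddle member on `t_eff ∈ [1/2, m/5]` (the two readings tile each straddler's `t_eff` row at `t* = m/5 ∈
  (0.573, 0.596)`, part 5 `hg1201E_census_P0_bank5`).
* §S3 OPTIMAL-DOPING COLUMN M19 (bar `0.5084577`; twin route's patch `n ∈ [67/80, 22/25]`): the same four doors and two readings on unc-2's
  `boxHg1201E_M19_slabLo/_slabHi`.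

Everything here is PROVED (no `sorry`, no new axiom). HONEST FRAMING: every stiffness statement is a one-sided CEILING (CONTROL/CALIBRATION, wording
class (xx1)), CONDITIONAL on strip-certificate hypotheses that do NOT exist at this writing (the pinned reads are in flight); the segment split is the
PEN's / captain's (BC3 of record), not proposed here; typing certifies containment arithmetic of SCREENING-GRADE / [float] members typed verbatim in
parts 1–5 — nothing about HgBa₂CuO₄₊δ; no row / hull / bar / word of record is touched; no `T_c`, phase or `dT_c/dP` sentence; no summit statement is
proved by this file.
-/

noncomputable section

namespace Summit.Ventures.CertifiedManyBodySolver.Downfold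

open Set NonemptyInterval
open Summit.Ventures.CertifiedManyBodySolver.Observables
open Literature.MathematicalPhysics.QuantumLattice

/-! ## §S1 The two K1 segments' exact `U`-reach on the eV axis; the ladder census of the split at `U′ = 5` -/

/-- **LOWER SEGMENT REACH = `[2.10, 2.50]` eV EXACTLY**: `U/t ∈ [7/2, 5]` for every `t_eff ∈ [1/2, 3/5]` iff `21/10 ≤ U ≤ 5/2` (`7/2 · 3/5`, `5 · 1/2`).
[folklore] -/
theorem hg1201E_K1lowU_Ureach_iff {U : ℝ} :
    (∀ t : ℝ, (1 / 2 : ℝ) ≤ t ∧ t ≤ 3 / 5 → (7 / 2 : ℝ) ≤ U / t ∧ U / t ≤ 5) ↔ ((21 / 10 : ℝ) ≤ U ∧ U ≤ 5 / 2) := by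
  constructor
  · intro h
    have hlo := (h (3 / 5) ⟨by norm_num, by norm_num⟩).1
    have hhi := (h (1 / 2) ⟨by norm_num, by norm_num⟩).2
    rw [le_div_iff₀ (by norm_num : (0 : ℝ) < 3 / 5)] at hlo
    rw [div_le_iff₀ (by norm_num : (0 : ℝ) < 1 / 2)] at hhi
    constructor <;> linarith
  · rintro hU t ht
    have ht0 : (0 : ℝ) < t := by linarith [ht.1]
    constructor
    · rw [le_div_iff₀ ht0]; linarith [hU.1, ht.2]
    · rw [div_le_iff₀ ht0]; linarith [hU.2, ht.1]

/-- **UPPER SEGMENT REACH = `[3.00, 4.40]` eV EXACTLY**: `U/t ∈ [5, 44/5]` for every `t_eff ∈ [1/2, 3/5]` iff `3 ≤ U ≤ 22/5` (`5 · 3/5`, `44/5 · 1/2`).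
[folklore] -/
theorem hg1201E_K1highU_Ureach_iff {U : ℝ} :
    (∀ t : ℝ, (1 / 2 : ℝ) ≤ t ∧ t ≤ 3 / 5 → (5 : ℝ) ≤ U / t ∧ U / t ≤ 44 / 5) ↔ ((3 : ℝ) ≤ U ∧ U ≤ 22 / 5) := by
  constructor
  · intro h
    have hlo := (h (3 / 5) ⟨by norm_num, by norm_num⟩).1
    have hhi := (h (1 / 2) ⟨by norm_num, by norm_num⟩).2
    rw [le_div_iff₀ (by norm_num : (0 : ℝ) < 3 / 5)] at hlo
    rw [div_le_iff₀ (by norm_num : (0 : ℝ) < 1 / 2)] at hhi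
    constructor <;> linarith
  · rintro hU t ht
    have ht0 : (0 : ℝ) < t := by linarith [ht.1]
    constructor
    · rw [le_div_iff₀ ht0]; linarith [hU.1, ht.2]
    · rw [div_le_iff₀ ht0]; linarith [hU.2, ht.1]

/-- **The 11 upper-reach members**: every `hg1201U_bank5_full` member other than mRPA@QSGW lies in `[3, 22/5]` (they lie in `[667/200, 437/100]` = in-house (D)
`3.335` … cGW `4.37`). [folklore] -/
theorem hg1201U_members11_mem_highReach {m : ℚ} (hm : m ∈ hg1201U_bank5_full) (hne : m ≠ hg1201U_sakakibara2017_mRPA_QSGW) :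
    (3 : ℚ) ≤ m ∧ m ≤ 22 / 5 := by
  simp only [hg1201U_bank5_full, List.mem_cons, List.mem_nil_iff, or_false] at hm
  rcases hm with rfl | rfl | rfl | rfl | rfl | rfl | rfl | rfl | rfl | rfl | rfl | rfl
  all_goals first
    | exact absurd rfl hne
    | (constructor <;> norm_num [hg1201U_inhouseD20, hg1201U_nilsson2019, hg1201U_sakakibara2017_cRPA_QSGW, hg1201U_sakakibara2017_mRPA_LDA,
        hg1201U_hirayama2019_LRFB, hg1201U_moree2022_d01, hg1201U_moree2022_d00, hg1201U_hirayama2018_cGW, hg1201U_moreeArita2024_d00,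
        hg1201U_moreeArita2024_d01, hg1201U_moreeArita2024_d02])

/-- **The three straddle members sit in the gap `(5/2, 3)` between the two reaches** (in fact in `[573/200, 149/50] = [2.865, 2.98]`), so `t* = m/5 ∈ [573/1000, 149/250]
⊂ (1/2, 3/5)`: their rung is in the lower segment iff `t_eff ≥ m/5` and in the upper iff `t_eff ≤ m/5`. [folklore] -/
theorem hg1201U_straddle_mem_gap {m : ℚ} (hm : m ∈ hg1201U_bank5_straddle) :
    ((573 / 200 : ℚ) ≤ m ∧ m ≤ 149 / 50) ∧ ((5 / 2 : ℚ) < m ∧ m < 3) ∧ ((1 / 2 : ℚ) < m / 5 ∧ m / 5 < 3 / 5) := by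
  simp only [hg1201U_bank5_straddle, List.mem_cons, List.mem_nil_iff, or_false] at hm
  rcases hm with rfl | rfl | rfl <;> refine ⟨⟨?_, ?_⟩, ⟨?_, ?_⟩, ⟨?_, ?_⟩⟩ <;>
    norm_num [hg1201U_inhouseW26, hg1201U_teranishi2018, hg1201U_vucicevic2026]

/-- **THE LADDER CENSUS OF THE K1 SPLIT AT `U′ = 5`** (numbers only): the Jang band `2.15 ± 0.05 = [21/10, 11/5]` lies in the lower reach `[21/10, 5/2]` (and is
the only member there); the 11 members `hg1201U_bank5_full ∖ {5.2}` lie in the upper reach `[3, 22/5]`; the 3 straddlers lie in neither; mRPA@QSGW `5.2 > 22/5`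
lies above both (third slab); `1 + 3 + 11 + 1 = 16 = |hg1201U_members|`. [folklore] -/
theorem hg1201E_K1split_ladder_census :
    ((21 / 10 : ℚ) ≤ hg1201U_jang2016 - hg1201U_jang2016_readErr ∧ hg1201U_jang2016 + hg1201U_jang2016_readErr ≤ 5 / 2) ∧
    (∀ m ∈ hg1201U_bank5_full, m ≠ hg1201U_sakakibara2017_mRPA_QSGW → (3 : ℚ) ≤ m ∧ m ≤ 22 / 5) ∧
    (∀ m ∈ hg1201U_bank5_straddle, (5 / 2 : ℚ) < m ∧ m < 3) ∧
    (22 / 5 : ℚ) < hg1201U_sakakibara2017_mRPA_QSGW ∧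
    1 + hg1201U_bank5_straddle.length + (hg1201U_bank5_full.length - 1) + 1 = hg1201U_members.length := by
  refine ⟨by constructor <;> norm_num [hg1201U_jang2016, hg1201U_jang2016_readErr], fun m hm hne => hg1201U_members11_mem_highReach hm hne,
    fun m hm => (hg1201U_straddle_mem_gap hm).2.1, by norm_num [hg1201U_sakakibara2017_mRPA_QSGW], by decide⟩

/-! ## §S2 p = ⅛ column (M19b, bar `0.5166800`): segment strip ⇒ slab ceiling ⇒ rungs -/

/-- **LOWER SEGMENT STRIP ⇒ slabLo CEILING**: a certified `c ≤ 0.5166800` on the lower-segment residual strip `t′ ∈ [−27/50, −13/25] × U ∈ [7/2, 5] × n ∈ [179/200, 183/200]`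
gives `StiffnessBoxCeilingBelow boxHg1201E_M19b_slabLo (5166800/10⁷)` (box-2's `U`-parametric strip cover + unc-2's slab door). CONDITIONAL on the strip hypothesis (the
shape box-1's adapters deliver from `stub_leftEdge_lowU` + K2). [cite: ScalapinoWhiteZhang1993, §II] [cite: HazraVermaRanderia2019, eqs. (2)-(6)] -/
theorem stiffnessBoxCeilingBelow_M19bslabLo_of_cornerStrip {c : ℚ} (hc : c ≤ 5166800 / 10000000)
    (h : ∀ tp ∈ Icc (-27 / 50 : ℝ) (-13 / 25), ∀ U ∈ Icc (7 / 2 : ℝ) 5, ∀ n ∈ Icc (179 / 200 : ℝ) (183 / 200),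
      ObsStiffnessSeqCeilingAt tp U n c) :
    StiffnessBoxCeilingBelow boxHg1201E_M19b_slabLo (5166800 / 10000000) :=
  boxHg1201E_M19b_slabLo_stiffnessBoxCeilingBelow_of_cellLeaf le_rfl (hg1201M19b_cell_of_cornerStrip hc h)

/-- **UPPER SEGMENT STRIP ⇒ slabHi CEILING** (`U ∈ [5, 44/5]`; from `stub_leftEdge_highU` + K2 via box-1's adapters). CONDITIONAL. [cite: ScalapinoWhiteZhang1993, §II]
[cite: HazraVermaRanderia2019, eqs. (2)-(6)] -/
theorem stiffnessBoxCeilingBelow_M19bslabHi_of_cornerStrip {c : ℚ} (hc : c ≤ 5166800 / 10000000)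
    (h : ∀ tp ∈ Icc (-27 / 50 : ℝ) (-13 / 25), ∀ U ∈ Icc (5 : ℝ) (44 / 5), ∀ n ∈ Icc (179 / 200 : ℝ) (183 / 200),
      ObsStiffnessSeqCeilingAt tp U n c) :
    StiffnessBoxCeilingBelow boxHg1201E_M19b_slabHi (5166800 / 10000000) :=
  boxHg1201E_M19b_slabHi_stiffnessBoxCeilingBelow_of_cellLeaf le_rfl (hg1201M19b_cell_of_cornerStrip hc h)

/-- **BOTH SEGMENT STRIPS ⇒ THE LEAF** (each with its own certified constant; the two-piece twin of box-2's `Hg1201M19b_StiffnessBoxCeiling_of_cornerStrip`).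
CONDITIONAL. [cite: ScalapinoWhiteZhang1993, §II] -/
theorem Hg1201M19b_StiffnessBoxCeiling_of_twoSegmentStrips {c₁ c₂ : ℚ} (hc₁ : c₁ ≤ 5166800 / 10000000) (hc₂ : c₂ ≤ 5166800 / 10000000)
    (h₁ : ∀ tp ∈ Icc (-27 / 50 : ℝ) (-13 / 25), ∀ U ∈ Icc (7 / 2 : ℝ) 5, ∀ n ∈ Icc (179 / 200 : ℝ) (183 / 200),
      ObsStiffnessSeqCeilingAt tp U n c₁)
    (h₂ : ∀ tp ∈ Icc (-27 / 50 : ℝ) (-13 / 25), ∀ U ∈ Icc (5 : ℝ) (44 / 5), ∀ n ∈ Icc (179 / 200 : ℝ) (183 / 200),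
      ObsStiffnessSeqCeilingAt tp U n c₂) :
    Hg1201M19b_StiffnessBoxCeiling := by
  obtain ⟨d₁, hd₁, hW₁⟩ := stiffnessBoxCeilingBelow_M19bslabLo_of_cornerStrip hc₁ h₁
  obtain ⟨d₂, hd₂, hW₂⟩ := stiffnessBoxCeilingBelow_M19bslabHi_of_cornerStrip hc₂ h₂
  exact Hg1201M19b_StiffnessBoxCeiling_of_slabWords le_rfl (fun p hp => (hW₁ p hp).mono hd₁) (fun p hp => (hW₂ p hp).mono hd₂)

/-- **WHAT A slabLo CEILING CERTIFIES ON THE LADDER** (the interim state «lower segment landed, upper pending»): ONE certified `c ≤ bar` (i) at every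
`U ∈ [21/10, 5/2]` eV — the whole Jang band — over every `t_eff ∈ [1/2, 3/5]`, `t′/t ∈ [−27/50, −43/100]`, `n ∈ [167/200, 183/200]`, and (ii) at the rung of each
STRADDLE member `m ∈ {2.865, 2.9462, 2.98}` on `t_eff ∈ [m/5, 3/5]` (where `m/t ≤ 5`). CONDITIONAL on the slabLo ceiling. [cite: ScalapinoWhiteZhang1993, §II] -/
theorem hg1201E_slabLo_rungs_of_ceiling {bar : ℚ} (h : StiffnessBoxCeilingBelow boxHg1201E_M19b_slabLo bar) :
    ∃ c : ℚ, c ≤ bar ∧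
      (∀ U t tp n : ℝ, ((21 / 10 : ℝ) ≤ U ∧ U ≤ 5 / 2) → hg1201E_M19b_t.Mem t → hg1201E_M19b_tp.Mem tp → hg1201E_M19b_n.Mem n →
        ObsStiffnessSeqCeilingAt tp (U / t) n c) ∧
      (∀ m ∈ hg1201U_bank5_straddle, ∀ t tp n : ℝ, ((m : ℝ) / 5 ≤ t ∧ t ≤ 3 / 5) → hg1201E_M19b_tp.Mem tp → hg1201E_M19b_n.Mem n →
        ObsStiffnessSeqCeilingAt tp ((m : ℝ) / t) n c) := by
  obtain ⟨c, hc, hW⟩ := h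
  refine ⟨c, hc, fun U t tp n hU ht htp hn => stiffnessWord_apply_oneBandPointE hW ?_,
    fun m hm t tp n ht htp hn => stiffnessWord_apply_oneBandPointE hW ?_⟩
  · have ht' := (Entry.mem_ofEnds_iff _ _ _ _ _).1 ht
    push_cast at ht'
    have hq := (hg1201E_K1lowU_Ureach_iff.2 hU) t ht'
    exact oneBandPointE_mem_M19b_sliceU (lo := 7 / 2) (hi := 5) (by norm_num) ⟨by push_cast; exact hq.1, by push_cast; exact hq.2⟩ htp hn ht
  · have hb := (hg1201U_straddle_mem_gap hm).1
    have hlo : ((573 / 200 : ℚ) : ℝ) ≤ (m : ℝ) := (Rat.cast_le (K := ℝ)).mpr hb.1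
    have hhi : (m : ℝ) ≤ ((149 / 50 : ℚ) : ℝ) := (Rat.cast_le (K := ℝ)).mpr hb.2
    push_cast at hlo hhi
    have ht1 : (1 / 2 : ℝ) ≤ t := by linarith [ht.1]
    have ht0 : (0 : ℝ) < t := by linarith
    have htE : hg1201E_M19b_t.Mem t := (Entry.mem_ofEnds_iff _ _ _ _ _).2 (by push_cast; exact ⟨ht1, ht.2⟩)
    refine oneBandPointE_mem_M19b_sliceU (lo := 7 / 2) (hi := 5) (by norm_num) ⟨?_, ?_⟩ htp hn htE
    · push_cast; rw [le_div_iff₀ ht0]; linarith [ht.2]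
    · push_cast; rw [div_le_iff₀ ht0]; linarith [ht.1]

/-- **WHAT A slabHi CEILING CERTIFIES ON THE LADDER** (the interim state «upper segment landed, lower pending», or the bank at `U† = 5` without the third slab):
ONE certified `c ≤ bar` (i) at every `U ∈ [3, 22/5]` eV — the 11 members `3.335 … 4.37` — over the whole M19b entries, and (ii) at the rung of each STRADDLE member
`m` on `t_eff ∈ [1/2, m/5]` (where `m/t ≥ 5`). With `hg1201E_slabLo_rungs_of_ceiling` (ii) the two segments tile each straddler's `t_eff` row at `t* = m/5`.
CONDITIONAL on the slabHi ceiling. [cite: ScalapinoWhiteZhang1993, §II] -/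
theorem hg1201E_slabHi_rungs_of_ceiling {bar : ℚ} (h : StiffnessBoxCeilingBelow boxHg1201E_M19b_slabHi bar) :
    ∃ c : ℚ, c ≤ bar ∧
      (∀ U t tp n : ℝ, ((3 : ℝ) ≤ U ∧ U ≤ 22 / 5) → hg1201E_M19b_t.Mem t → hg1201E_M19b_tp.Mem tp → hg1201E_M19b_n.Mem n →
        ObsStiffnessSeqCeilingAt tp (U / t) n c) ∧
      (∀ m ∈ hg1201U_bank5_straddle, ∀ t tp n : ℝ, ((1 / 2 : ℝ) ≤ t ∧ t ≤ (m : ℝ) / 5) → hg1201E_M19b_tp.Mem tp → hg1201E_M19b_n.Mem n →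
        ObsStiffnessSeqCeilingAt tp ((m : ℝ) / t) n c) := by
  obtain ⟨c, hc, hW⟩ := h
  refine ⟨c, hc, fun U t tp n hU ht htp hn => stiffnessWord_apply_oneBandPointE hW ?_,
    fun m hm t tp n ht htp hn => stiffnessWord_apply_oneBandPointE hW ?_⟩
  · have ht' := (Entry.mem_ofEnds_iff _ _ _ _ _).1 ht
    push_cast at ht'
    have hq := (hg1201E_K1highU_Ureach_iff.2 hU) t ht'
    exact oneBandPointE_mem_M19b_sliceU (lo := 5) (hi := 44 / 5) (by norm_num) ⟨by push_cast; exact hq.1, by push_cast; exact hq.2⟩ htp hn ht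
  · have hb := (hg1201U_straddle_mem_gap hm).1
    have hlo : ((573 / 200 : ℚ) : ℝ) ≤ (m : ℝ) := (Rat.cast_le (K := ℝ)).mpr hb.1
    have hhi : (m : ℝ) ≤ ((149 / 50 : ℚ) : ℝ) := (Rat.cast_le (K := ℝ)).mpr hb.2
    push_cast at hlo hhi
    have ht2 : t ≤ (3 / 5 : ℝ) := by linarith [ht.2]
    have ht0 : (0 : ℝ) < t := by linarith [ht.1]
    have htE : hg1201E_M19b_t.Mem t := (Entry.mem_ofEnds_iff _ _ _ _ _).2 (by push_cast; exact ⟨ht.1, ht2⟩)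
    refine oneBandPointE_mem_M19b_sliceU (lo := 5) (hi := 44 / 5) (by norm_num) ⟨?_, ?_⟩ htp hn htE
    · push_cast; rw [le_div_iff₀ ht0]; linarith [ht.2]
    · push_cast; rw [div_le_iff₀ ht0]; linarith [ht.1]

/-- **Member-list form of the two interim readings**: a slabLo ceiling covers the Jang member `43/20` at every `t_eff`; a slabHi ceiling covers each of the 11 NAMED
members of `hg1201U_bank5_full ∖ {mRPA@QSGW}` at every `t_eff` (whole M19b `t′/t`, `n` entries). CONDITIONAL. [cite: ScalapinoWhiteZhang1993, §II] -/
theorem hg1201U_members_coveredBy_segmentCeilings {barLo barHi : ℚ} :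
    (StiffnessBoxCeilingBelow boxHg1201E_M19b_slabLo barLo → ∃ c : ℚ, c ≤ barLo ∧ ∀ t tp n : ℝ, hg1201E_M19b_t.Mem t → hg1201E_M19b_tp.Mem tp →
        hg1201E_M19b_n.Mem n → ObsStiffnessSeqCeilingAt tp ((hg1201U_jang2016 : ℝ) / t) n c) ∧
    (StiffnessBoxCeilingBelow boxHg1201E_M19b_slabHi barHi → ∃ c : ℚ, c ≤ barHi ∧ ∀ m ∈ hg1201U_bank5_full, m ≠ hg1201U_sakakibara2017_mRPA_QSGW →
        ∀ t tp n : ℝ, hg1201E_M19b_t.Mem t → hg1201E_M19b_tp.Mem tp → hg1201E_M19b_n.Mem n → ObsStiffnessSeqCeilingAt tp ((m : ℝ) / t) n c) := by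
  refine ⟨fun h => ?_, fun h => ?_⟩
  · obtain ⟨c, hc, hW, -⟩ := hg1201E_slabLo_rungs_of_ceiling h
    refine ⟨c, hc, fun t tp n ht htp hn => hW _ t tp n ⟨?_, ?_⟩ ht htp hn⟩ <;> norm_num [hg1201U_jang2016]
  · obtain ⟨c, hc, hW, -⟩ := hg1201E_slabHi_rungs_of_ceiling h
    refine ⟨c, hc, fun m hm hne t tp n ht htp hn => hW _ t tp n ?_ ht htp hn⟩
    have hb := hg1201U_members11_mem_highReach hm hne
    have hlo : ((3 : ℚ) : ℝ) ≤ (m : ℝ) := (Rat.cast_le (K := ℝ)).mpr hb.1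
    have hhi : (m : ℝ) ≤ ((22 / 5 : ℚ) : ℝ) := (Rat.cast_le (K := ℝ)).mpr hb.2
    push_cast at hlo hhi
    exact ⟨hlo, hhi⟩

/-! ## §S3 Optimal-doping column M19 (bar `0.5084577`; the twin route's corner patch `n ∈ [67/80, 22/25]`) -/

/-- **M19, LOWER SEGMENT PATCH ⇒ slabLo CEILING**: a certified `c ≤ 0.5084577` on `t′ ∈ [−27/50, −13/25] × U ∈ [7/2, 5] × n ∈ [67/80, 22/25]` gives
`StiffnessBoxCeilingBelow boxHg1201E_M19_slabLo (5084577/10⁷)` (box-2 `hg1201M19_cell_of_cornerPatch` + unc-2's M19 slab door). CONDITIONAL.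
[cite: ScalapinoWhiteZhang1993, §II] [cite: HazraVermaRanderia2019, eqs. (2)-(6)] -/
theorem stiffnessBoxCeilingBelow_M19slabLo_of_cornerPatch {c : ℚ} (hc : c ≤ 5084577 / 10000000)
    (h : ∀ tp ∈ Icc (-27 / 50 : ℝ) (-13 / 25), ∀ U ∈ Icc (7 / 2 : ℝ) 5, ∀ n ∈ Icc (67 / 80 : ℝ) (22 / 25),
      ObsStiffnessSeqCeilingAt tp U n c) :
    StiffnessBoxCeilingBelow boxHg1201E_M19_slabLo (5084577 / 10000000) :=
  (boxHg1201E_M19_slabs_stiffnessBoxCeilingBelow_of_cellLeaf (c := 5084577 / 10000000) le_rfl).1 (hg1201M19_cell_of_cornerPatch hc h)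

/-- **M19, UPPER SEGMENT PATCH ⇒ slabHi CEILING** (`U ∈ [5, 44/5]`). CONDITIONAL. [cite: ScalapinoWhiteZhang1993, §II] [cite: HazraVermaRanderia2019, eqs. (2)-(6)] -/
theorem stiffnessBoxCeilingBelow_M19slabHi_of_cornerPatch {c : ℚ} (hc : c ≤ 5084577 / 10000000)
    (h : ∀ tp ∈ Icc (-27 / 50 : ℝ) (-13 / 25), ∀ U ∈ Icc (5 : ℝ) (44 / 5), ∀ n ∈ Icc (67 / 80 : ℝ) (22 / 25),
      ObsStiffnessSeqCeilingAt tp U n c) :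
    StiffnessBoxCeilingBelow boxHg1201E_M19_slabHi (5084577 / 10000000) :=
  (boxHg1201E_M19_slabs_stiffnessBoxCeilingBelow_of_cellLeaf (c := 5084577 / 10000000) le_rfl).2.1 (hg1201M19_cell_of_cornerPatch hc h)

/-- **M19: BOTH SEGMENT PATCHES ⇒ THE M19 LEAF «MOS2-hg1201-M19»** (two constants). CONDITIONAL. [cite: ScalapinoWhiteZhang1993, §II] -/
theorem Hg1201M19_StiffnessBoxCeiling_of_twoSegmentPatches {c₁ c₂ : ℚ} (hc₁ : c₁ ≤ 5084577 / 10000000) (hc₂ : c₂ ≤ 5084577 / 10000000)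
    (h₁ : ∀ tp ∈ Icc (-27 / 50 : ℝ) (-13 / 25), ∀ U ∈ Icc (7 / 2 : ℝ) 5, ∀ n ∈ Icc (67 / 80 : ℝ) (22 / 25),
      ObsStiffnessSeqCeilingAt tp U n c₁)
    (h₂ : ∀ tp ∈ Icc (-27 / 50 : ℝ) (-13 / 25), ∀ U ∈ Icc (5 : ℝ) (44 / 5), ∀ n ∈ Icc (67 / 80 : ℝ) (22 / 25),
      ObsStiffnessSeqCeilingAt tp U n c₂) :
    Hg1201M19_StiffnessBoxCeiling := by
  obtain ⟨d₁, hd₁, hW₁⟩ := stiffnessBoxCeilingBelow_M19slabLo_of_cornerPatch hc₁ h₁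
  obtain ⟨d₂, hd₂, hW₂⟩ := stiffnessBoxCeilingBelow_M19slabHi_of_cornerPatch hc₂ h₂
  exact Hg1201M19_StiffnessBoxCeiling_of_slabWords le_rfl (fun p hp => (hW₁ p hp).mono hd₁) (fun p hp => (hW₂ p hp).mono hd₂)

/-- **M19: what a slabLo ceiling certifies on the ladder** — every `U ∈ [21/10, 5/2]` eV over the M19 entries (`n ∈ [4/5, 22/25]`), and each straddle member on
`t_eff ∈ [m/5, 3/5]`. CONDITIONAL. [cite: ScalapinoWhiteZhang1993, §II] -/
theorem hg1201E_M19slabLo_rungs_of_ceiling {bar : ℚ} (h : StiffnessBoxCeilingBelow boxHg1201E_M19_slabLo bar) :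
    ∃ c : ℚ, c ≤ bar ∧
      (∀ U t tp n : ℝ, ((21 / 10 : ℝ) ≤ U ∧ U ≤ 5 / 2) → hg1201E_M19_t.Mem t → hg1201E_M19_tp.Mem tp → hg1201E_M19_n.Mem n →
        ObsStiffnessSeqCeilingAt tp (U / t) n c) ∧
      (∀ m ∈ hg1201U_bank5_straddle, ∀ t tp n : ℝ, ((m : ℝ) / 5 ≤ t ∧ t ≤ 3 / 5) → hg1201E_M19_tp.Mem tp → hg1201E_M19_n.Mem n →
        ObsStiffnessSeqCeilingAt tp ((m : ℝ) / t) n c) := by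
  obtain ⟨c, hc, hW⟩ := h
  refine ⟨c, hc, fun U t tp n hU ht htp hn => stiffnessWord_apply_oneBandPointE hW ?_,
    fun m hm t tp n ht htp hn => stiffnessWord_apply_oneBandPointE hW ?_⟩
  · have ht' := (Entry.mem_ofEnds_iff _ _ _ _ _).1 ht
    push_cast at ht'
    have hq := (hg1201E_K1lowU_Ureach_iff.2 hU) t ht'
    exact oneBandPointE_mem_M19_sliceU (lo := 7 / 2) (hi := 5) (by norm_num) ⟨by push_cast; exact hq.1, by push_cast; exact hq.2⟩ htp hn ht
  · have hb := (hg1201U_straddle_mem_gap hm).1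
    have hlo : ((573 / 200 : ℚ) : ℝ) ≤ (m : ℝ) := (Rat.cast_le (K := ℝ)).mpr hb.1
    have hhi : (m : ℝ) ≤ ((149 / 50 : ℚ) : ℝ) := (Rat.cast_le (K := ℝ)).mpr hb.2
    push_cast at hlo hhi
    have ht1 : (1 / 2 : ℝ) ≤ t := by linarith [ht.1]
    have ht0 : (0 : ℝ) < t := by linarith
    have htE : hg1201E_M19_t.Mem t := (Entry.mem_ofEnds_iff _ _ _ _ _).2 (by push_cast; exact ⟨ht1, ht.2⟩)
    refine oneBandPointE_mem_M19_sliceU (lo := 7 / 2) (hi := 5) (by norm_num) ⟨?_, ?_⟩ htp hn htE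
    · push_cast; rw [le_div_iff₀ ht0]; linarith [ht.2]
    · push_cast; rw [div_le_iff₀ ht0]; linarith [ht.1]

/-- **M19: what a slabHi ceiling certifies on the ladder** — every `U ∈ [3, 22/5]` eV over the M19 entries, and each straddle member on `t_eff ∈ [1/2, m/5]`.
CONDITIONAL. [cite: ScalapinoWhiteZhang1993, §II] -/
theorem hg1201E_M19slabHi_rungs_of_ceiling {bar : ℚ} (h : StiffnessBoxCeilingBelow boxHg1201E_M19_slabHi bar) :
    ∃ c : ℚ, c ≤ bar ∧
      (∀ U t tp n : ℝ, ((3 : ℝ) ≤ U ∧ U ≤ 22 / 5) → hg1201E_M19_t.Mem t → hg1201E_M19_tp.Mem tp → hg1201E_M19_n.Mem n →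
        ObsStiffnessSeqCeilingAt tp (U / t) n c) ∧
      (∀ m ∈ hg1201U_bank5_straddle, ∀ t tp n : ℝ, ((1 / 2 : ℝ) ≤ t ∧ t ≤ (m : ℝ) / 5) → hg1201E_M19_tp.Mem tp → hg1201E_M19_n.Mem n →
        ObsStiffnessSeqCeilingAt tp ((m : ℝ) / t) n c) := by
  obtain ⟨c, hc, hW⟩ := h
  refine ⟨c, hc, fun U t tp n hU ht htp hn => stiffnessWord_apply_oneBandPointE hW ?_,
    fun m hm t tp n ht htp hn => stiffnessWord_apply_oneBandPointE hW ?_⟩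
  · have ht' := (Entry.mem_ofEnds_iff _ _ _ _ _).1 ht
    push_cast at ht'
    have hq := (hg1201E_K1highU_Ureach_iff.2 hU) t ht'
    exact oneBandPointE_mem_M19_sliceU (lo := 5) (hi := 44 / 5) (by norm_num) ⟨by push_cast; exact hq.1, by push_cast; exact hq.2⟩ htp hn ht
  · have hb := (hg1201U_straddle_mem_gap hm).1
    have hlo : ((573 / 200 : ℚ) : ℝ) ≤ (m : ℝ) := (Rat.cast_le (K := ℝ)).mpr hb.1
    have hhi : (m : ℝ) ≤ ((149 / 50 : ℚ) : ℝ) := (Rat.cast_le (K := ℝ)).mpr hb.2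
    push_cast at hlo hhi
    have ht2 : t ≤ (3 / 5 : ℝ) := by linarith [ht.2]
    have ht0 : (0 : ℝ) < t := by linarith [ht.1]
    have htE : hg1201E_M19_t.Mem t := (Entry.mem_ofEnds_iff _ _ _ _ _).2 (by push_cast; exact ⟨ht.1, ht2⟩)
    refine oneBandPointE_mem_M19_sliceU (lo := 5) (hi := 44 / 5) (by norm_num) ⟨?_, ?_⟩ htp hn htE
    · push_cast; rw [le_div_iff₀ ht0]; linarith [ht.2]
    · push_cast; rw [div_le_iff₀ ht0]; linarith [ht.1]

end Summit.Ventures.CertifiedManyBodySolver.Downfold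

end
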